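import Summits.RiemannHypothesis.RiemannHypothesis.Theorems.SemilocalLogAtomsB
import Summits.RiemannHypothesis.RiemannHypothesis.Theorems.SemilocalLogAtomsE
import HarnessLib

/-!
# Log-atom enclosures (I): the atoms `97`, `101`, `103`

Cell `rh-explicit` (HOME `run/shared/lean/pub/rh-explicit/`), seat cc-s2-4 gen10 (A4 lane, the Lean side).  Sequel of
`SemilocalLogAtoms{,B,…,H}.lean`: the rational enclosures `(lo, hi, wlo, whi)` of `log p` and of the weights `log p/√p` for
`p = 97, 101, 103`, needed (with `…J.lean`: `107`, `109`) by the negative certificates of the walls `q = 103` (`S = {p ≤ 101}`,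
window `b < (log 107)/2`), `q = 109` (`S = {p ≤ 107}`, `b < (log 113)/2`) and `q = 113` (`S = {p ≤ 109}`, `b < (log 117)/2`):
7-term log series (`Real.abs_log_sub_add_sum_range_le`) at `97 = 96·(1 + 1/96)`, `101 = 100·(1 + 1/100)`, `103 = 102·(1 + 1/102)`
with the tree's `log 2` (d20), `log 3`, `log 5`, `log 17`; square roots by squaring.  The fine enclosures are named `log…Lo11/Hi11`
(the coarse `logNinetySevenLo`, `logHundredOneLo` live in `SemilocalLogAtomsH.lean`).  (The wall `q = 101` — `S = {p ≤ 97}`, window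
`< (log 103)/2` — has NO row: the degree-21 polynomial class does not reach within `½·log(103/101)` of that wall; CC4-LEAN §15.)

Folklore numerics throughout; nothing here bears on RH.
-/

set_option autoImplicit false
set_option linter.dupNamespace false  -- the mandated namespace repeats `RiemannHypothesis`

noncomputable section

namespace Summit.RiemannHypothesis.RiemannHypothesis.Theorems.SemilocalPolyWitness

open Real
open Literature.NumberTheory.LFunctions
open Literature.Analysis.SpecialFunctions.Real
open Summit.RiemannHypothesis.RiemannHypothesis.Theorems.MotivicDoor.SemilocalMarkov

/-! ### The atom `97` (`log 97` from `97 = 96·(1 + 1/96)`) -/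

/-- `(4.57471097840) < log 97` (`Real.abs_log_sub_add_sum_range_le` at `x = -1/96`, 7 terms). -/
theorem log_ninetyseven_gt : (4.57471097840 : ℝ) < Real.log 97 := by
  have t : |(-(1 : ℝ) / 96)| < 1 := by rw [abs_of_neg (by norm_num)]; norm_num
  have z := Real.abs_log_sub_add_sum_range_le t 7
  rw [show |(-(1 : ℝ) / 96)| = 1 / 96 by rw [abs_of_neg (by norm_num)]; norm_num] at z
  norm_num [Finset.sum_range_succ] at z
  have e : Real.log (97 / 96) = Real.log 97 - (5 * Real.log 2 + Real.log 3) := by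
    rw [Real.log_div (by norm_num) (by norm_num), show (96 : ℝ) = 2 ^ 5 * 3 by norm_num, Real.log_mul (by norm_num) (by norm_num), Real.log_pow]
    push_cast; ring
  rw [e] at z
  have h2 := Literature.Analysis.SpecialFunctions.Real.log_two_gt_d20
  have h3 := logThreeLo_le
  rw [logThreeLo] at h3
  push_cast at h3
  obtain ⟨z1, z2⟩ := abs_le.1 z
  linarith

/-- `log 97 < 4.57471097861` (`Real.abs_log_sub_add_sum_range_le` at `x = -1/96`, 7 terms). -/
theorem log_ninetyseven_lt : Real.log 97 < 4.57471097861 := by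
  have t : |(-(1 : ℝ) / 96)| < 1 := by rw [abs_of_neg (by norm_num)]; norm_num
  have z := Real.abs_log_sub_add_sum_range_le t 7
  rw [show |(-(1 : ℝ) / 96)| = 1 / 96 by rw [abs_of_neg (by norm_num)]; norm_num] at z
  norm_num [Finset.sum_range_succ] at z
  have e : Real.log (97 / 96) = Real.log 97 - (5 * Real.log 2 + Real.log 3) := by
    rw [Real.log_div (by norm_num) (by norm_num), show (96 : ℝ) = 2 ^ 5 * 3 by norm_num, Real.log_mul (by norm_num) (by norm_num), Real.log_pow]
    push_cast; ring
  rw [e] at z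
  have h2 := Literature.Analysis.SpecialFunctions.Real.log_two_lt_d20
  have h3 := log_three_le_logThreeHi
  rw [logThreeHi] at h3
  push_cast at h3
  obtain ⟨z1, z2⟩ := abs_le.1 z
  linarith

/-- lower decimal of `log 97` (fine) -/
def logNinetySevenLo11 : ℚ := 457471097840 / 100000000000
/-- upper decimal of `log 97` -/
def logNinetySevenHi11 : ℚ := 457471097861 / 100000000000
/-- `logNinetySevenLo11 ≤ log 97`. -/
theorem logNinetySevenLo11_le : (logNinetySevenLo11 : ℝ) ≤ Real.log 97 := by
  rw [logNinetySevenLo11]; push_cast; linarith [log_ninetyseven_gt]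
/-- `log 97 ≤ logNinetySevenHi11`. -/
theorem log_ninetyseven_le_logNinetySevenHi11 : Real.log 97 ≤ (logNinetySevenHi11 : ℝ) := by
  rw [logNinetySevenHi11]; push_cast; linarith [log_ninetyseven_lt]
/-- `9.848857801796104 ≤ √97 ≤ 9.848857801796104`. -/
def sqrtNinetySevenLo : ℚ := 98488578017961047 / 10000000000000000
/-- upper decimal of `√97` -/
def sqrtNinetySevenHi : ℚ := 98488578017961048 / 10000000000000000
/-- The atom `97`: weight `log 97/√97`. -/
def atomNinetySeven : ℕ × AtomQ :=
  (97, ⟨logNinetySevenLo11, logNinetySevenHi11, logNinetySevenLo11 / sqrtNinetySevenHi, logNinetySevenHi11 / sqrtNinetySevenLo⟩)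
/-- `atomNinetySeven` encloses the atom `97` for any `S ∋ 97`. -/
theorem atomNinetySeven_encl {S : Finset ℕ} (h : 97 ∈ S) :
    (atomNinetySeven.2.lo : ℝ) ≤ Real.log atomNinetySeven.1 ∧ Real.log atomNinetySeven.1 ≤ (atomNinetySeven.2.hi : ℝ) ∧
      (atomNinetySeven.2.wlo : ℝ) ≤ weilSemilocalCoeff S atomNinetySeven.1 ∧
      weilSemilocalCoeff S atomNinetySeven.1 ≤ (atomNinetySeven.2.whi : ℝ) := by
  simp only [atomNinetySeven]
  push_cast
  have h0 := prime_atom_encl (by norm_num : Nat.Prime 97) h (lo := logNinetySevenLo11) (hi := logNinetySevenHi11)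
    (slo := sqrtNinetySevenLo) (shi := sqrtNinetySevenHi) (by exact_mod_cast logNinetySevenLo11_le)
    (by exact_mod_cast log_ninetyseven_le_logNinetySevenHi11) (by rw [logNinetySevenLo11]; norm_num)
    (ratCast_le_sqrt (by rw [sqrtNinetySevenLo]; norm_num) (by rw [sqrtNinetySevenLo]; norm_num))
    (sqrt_le_ratCast (by rw [sqrtNinetySevenHi]; norm_num) (by rw [sqrtNinetySevenHi]; norm_num))
    (by rw [sqrtNinetySevenLo]; norm_num)
  push_cast at h0
  exact h0

/-! ### The atom `101` (`log 101` from `101 = 100·(1 + 1/100)`) -/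

/-- `(4.61512051663) < log 101` (`Real.abs_log_sub_add_sum_range_le` at `x = -1/100`, 7 terms). -/
theorem log_hundredone_gt : (4.61512051663 : ℝ) < Real.log 101 := by
  have t : |(-(1 : ℝ) / 100)| < 1 := by rw [abs_of_neg (by norm_num)]; norm_num
  have z := Real.abs_log_sub_add_sum_range_le t 7
  rw [show |(-(1 : ℝ) / 100)| = 1 / 100 by rw [abs_of_neg (by norm_num)]; norm_num] at z
  norm_num [Finset.sum_range_succ] at z
  have e : Real.log (101 / 100) = Real.log 101 - (2 * Real.log 2 + 2 * Real.log 5) := by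
    rw [Real.log_div (by norm_num) (by norm_num), show (100 : ℝ) = 2 ^ 2 * 5 ^ 2 by norm_num, Real.log_mul (by norm_num) (by norm_num), Real.log_pow, Real.log_pow]
    push_cast; ring
  rw [e] at z
  have h2 := Literature.Analysis.SpecialFunctions.Real.log_two_gt_d20
  have h5 := logFiveLo_le
  rw [logFiveLo] at h5
  push_cast at h5
  obtain ⟨z1, z2⟩ := abs_le.1 z
  linarith

/-- `log 101 < 4.61512051704` (`Real.abs_log_sub_add_sum_range_le` at `x = -1/100`, 7 terms). -/
theorem log_hundredone_lt : Real.log 101 < 4.61512051704 := by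
  have t : |(-(1 : ℝ) / 100)| < 1 := by rw [abs_of_neg (by norm_num)]; norm_num
  have z := Real.abs_log_sub_add_sum_range_le t 7
  rw [show |(-(1 : ℝ) / 100)| = 1 / 100 by rw [abs_of_neg (by norm_num)]; norm_num] at z
  norm_num [Finset.sum_range_succ] at z
  have e : Real.log (101 / 100) = Real.log 101 - (2 * Real.log 2 + 2 * Real.log 5) := by
    rw [Real.log_div (by norm_num) (by norm_num), show (100 : ℝ) = 2 ^ 2 * 5 ^ 2 by norm_num, Real.log_mul (by norm_num) (by norm_num), Real.log_pow, Real.log_pow]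
    push_cast; ring
  rw [e] at z
  have h2 := Literature.Analysis.SpecialFunctions.Real.log_two_lt_d20
  have h5 := log_five_le_logFiveHi
  rw [logFiveHi] at h5
  push_cast at h5
  obtain ⟨z1, z2⟩ := abs_le.1 z
  linarith

/-- lower decimal of `log 101` (fine) -/
def logHundredOneLo11 : ℚ := 461512051663 / 100000000000
/-- upper decimal of `log 101` -/
def logHundredOneHi11 : ℚ := 461512051704 / 100000000000
/-- `logHundredOneLo11 ≤ log 101`. -/
theorem logHundredOneLo11_le : (logHundredOneLo11 : ℝ) ≤ Real.log 101 := by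
  rw [logHundredOneLo11]; push_cast; linarith [log_hundredone_gt]
/-- `log 101 ≤ logHundredOneHi11`. -/
theorem log_hundredone_le_logHundredOneHi11 : Real.log 101 ≤ (logHundredOneHi11 : ℝ) := by
  rw [logHundredOneHi11]; push_cast; linarith [log_hundredone_lt]
/-- `10.04987562112089 ≤ √101 ≤ 10.04987562112089`. -/
def sqrtHundredOneLo : ℚ := 100498756211208902 / 10000000000000000
/-- upper decimal of `√101` -/
def sqrtHundredOneHi : ℚ := 100498756211208903 / 10000000000000000
/-- The atom `101`: weight `log 101/√101`. -/
def atomHundredOne : ℕ × AtomQ :=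
  (101, ⟨logHundredOneLo11, logHundredOneHi11, logHundredOneLo11 / sqrtHundredOneHi, logHundredOneHi11 / sqrtHundredOneLo⟩)
/-- `atomHundredOne` encloses the atom `101` for any `S ∋ 101`. -/
theorem atomHundredOne_encl {S : Finset ℕ} (h : 101 ∈ S) :
    (atomHundredOne.2.lo : ℝ) ≤ Real.log atomHundredOne.1 ∧ Real.log atomHundredOne.1 ≤ (atomHundredOne.2.hi : ℝ) ∧
      (atomHundredOne.2.wlo : ℝ) ≤ weilSemilocalCoeff S atomHundredOne.1 ∧
      weilSemilocalCoeff S atomHundredOne.1 ≤ (atomHundredOne.2.whi : ℝ) := by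
  simp only [atomHundredOne]
  push_cast
  have h0 := prime_atom_encl (by norm_num : Nat.Prime 101) h (lo := logHundredOneLo11) (hi := logHundredOneHi11)
    (slo := sqrtHundredOneLo) (shi := sqrtHundredOneHi) (by exact_mod_cast logHundredOneLo11_le)
    (by exact_mod_cast log_hundredone_le_logHundredOneHi11) (by rw [logHundredOneLo11]; norm_num)
    (ratCast_le_sqrt (by rw [sqrtHundredOneLo]; norm_num) (by rw [sqrtHundredOneLo]; norm_num))
    (sqrt_le_ratCast (by rw [sqrtHundredOneHi]; norm_num) (by rw [sqrtHundredOneHi]; norm_num))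
    (by rw [sqrtHundredOneLo]; norm_num)
  push_cast at h0
  exact h0

/-! ### The atom `103` (`log 103` from `103 = 102·(1 + 1/102)`) -/

/-- `(4.63472898812) < log 103` (`Real.abs_log_sub_add_sum_range_le` at `x = -1/102`, 7 terms). -/
theorem log_hundredthree_gt : (4.63472898812 : ℝ) < Real.log 103 := by
  have t : |(-(1 : ℝ) / 102)| < 1 := by rw [abs_of_neg (by norm_num)]; norm_num
  have z := Real.abs_log_sub_add_sum_range_le t 7
  rw [show |(-(1 : ℝ) / 102)| = 1 / 102 by rw [abs_of_neg (by norm_num)]; norm_num] at z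
  norm_num [Finset.sum_range_succ] at z
  have e : Real.log (103 / 102) = Real.log 103 - (Real.log 2 + Real.log 3 + Real.log 17) := by
    rw [Real.log_div (by norm_num) (by norm_num), show (102 : ℝ) = 2 * 3 * 17 by norm_num, Real.log_mul (by norm_num) (by norm_num), Real.log_mul (by norm_num) (by norm_num)]
  rw [e] at z
  have h2 := Literature.Analysis.SpecialFunctions.Real.log_two_gt_d20
  have h3 := logThreeLo_le
  rw [logThreeLo] at h3
  push_cast at h3
  have h17 := logSeventeenLo_le
  rw [logSeventeenLo] at h17
  push_cast at h17
  obtain ⟨z1, z2⟩ := abs_le.1 z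
  linarith

/-- `log 103 < 4.63472898834` (`Real.abs_log_sub_add_sum_range_le` at `x = -1/102`, 7 terms). -/
theorem log_hundredthree_lt : Real.log 103 < 4.63472898834 := by
  have t : |(-(1 : ℝ) / 102)| < 1 := by rw [abs_of_neg (by norm_num)]; norm_num
  have z := Real.abs_log_sub_add_sum_range_le t 7
  rw [show |(-(1 : ℝ) / 102)| = 1 / 102 by rw [abs_of_neg (by norm_num)]; norm_num] at z
  norm_num [Finset.sum_range_succ] at z
  have e : Real.log (103 / 102) = Real.log 103 - (Real.log 2 + Real.log 3 + Real.log 17) := by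
    rw [Real.log_div (by norm_num) (by norm_num), show (102 : ℝ) = 2 * 3 * 17 by norm_num, Real.log_mul (by norm_num) (by norm_num), Real.log_mul (by norm_num) (by norm_num)]
  rw [e] at z
  have h2 := Literature.Analysis.SpecialFunctions.Real.log_two_lt_d20
  have h3 := log_three_le_logThreeHi
  rw [logThreeHi] at h3
  push_cast at h3
  have h17 := log_seventeen_le_logSeventeenHi
  rw [logSeventeenHi] at h17
  push_cast at h17
  obtain ⟨z1, z2⟩ := abs_le.1 z
  linarith

/-- lower decimal of `log 103` (fine) -/
def logHundredThreeLo11 : ℚ := 463472898812 / 100000000000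
/-- upper decimal of `log 103` -/
def logHundredThreeHi11 : ℚ := 463472898834 / 100000000000
/-- `logHundredThreeLo11 ≤ log 103`. -/
theorem logHundredThreeLo11_le : (logHundredThreeLo11 : ℝ) ≤ Real.log 103 := by
  rw [logHundredThreeLo11]; push_cast; linarith [log_hundredthree_gt]
/-- `log 103 ≤ logHundredThreeHi11`. -/
theorem log_hundredthree_le_logHundredThreeHi11 : Real.log 103 ≤ (logHundredThreeHi11 : ℝ) := by
  rw [logHundredThreeHi11]; push_cast; linarith [log_hundredthree_lt]
/-- `10.14889156509222 ≤ √103 ≤ 10.14889156509222`. -/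
def sqrtHundredThreeLo : ℚ := 101488915650922194 / 10000000000000000
/-- upper decimal of `√103` -/
def sqrtHundredThreeHi : ℚ := 101488915650922195 / 10000000000000000
/-- The atom `103`: weight `log 103/√103`. -/
def atomHundredThree : ℕ × AtomQ :=
  (103, ⟨logHundredThreeLo11, logHundredThreeHi11, logHundredThreeLo11 / sqrtHundredThreeHi, logHundredThreeHi11 / sqrtHundredThreeLo⟩)
/-- `atomHundredThree` encloses the atom `103` for any `S ∋ 103`. -/
theorem atomHundredThree_encl {S : Finset ℕ} (h : 103 ∈ S) :
    (atomHundredThree.2.lo : ℝ) ≤ Real.log atomHundredThree.1 ∧ Real.log atomHundredThree.1 ≤ (atomHundredThree.2.hi : ℝ) ∧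
      (atomHundredThree.2.wlo : ℝ) ≤ weilSemilocalCoeff S atomHundredThree.1 ∧
      weilSemilocalCoeff S atomHundredThree.1 ≤ (atomHundredThree.2.whi : ℝ) := by
  simp only [atomHundredThree]
  push_cast
  have h0 := prime_atom_encl (by norm_num : Nat.Prime 103) h (lo := logHundredThreeLo11) (hi := logHundredThreeHi11)
    (slo := sqrtHundredThreeLo) (shi := sqrtHundredThreeHi) (by exact_mod_cast logHundredThreeLo11_le)
    (by exact_mod_cast log_hundredthree_le_logHundredThreeHi11) (by rw [logHundredThreeLo11]; norm_num)
    (ratCast_le_sqrt (by rw [sqrtHundredThreeLo]; norm_num) (by rw [sqrtHundredThreeLo]; norm_num))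
    (sqrt_le_ratCast (by rw [sqrtHundredThreeHi]; norm_num) (by rw [sqrtHundredThreeHi]; norm_num))
    (by rw [sqrtHundredThreeLo]; norm_num)
  push_cast at h0
  exact h0

end Summit.RiemannHypothesis.RiemannHypothesis.Theorems.SemilocalPolyWitness

end
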